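import Mathlib.Analysis.InnerProductSpace.Basic
import Mathlib.Analysis.Normed.Operator.Basic
import Literature.MathematicalPhysics.KineticTheory.HardSphereEuler
import HarnessLib

/-!
# The collision-difference mark `ψ_T` is `1`-Lipschitz in the unit normal (line `Sketch` v8, crux
# `LambertianContactSwap.ContactAngleEquidistribution`, stmt-AtomisticToContinuum-12097)

Helper file (`--supports stmt-AtomisticToContinuum-12097`, registered stub `stub_psiT_lipschitz`). For a bounded
operator `T` on `ℝ³` with `‖T‖ ≤ 1` and the quadratic observable `q(v) = ⟪v, T v⟫`, the collisional change of
`q(v) + q(w)` under the elastic reflection of the pair `(v, w)` along a unit normal `ω`,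
`Dq_T(v, w, ω) = q(v − cω) + q(w + cω) − q(v) − q(w)`, `c = ⟪v − w, ω⟫`, expands by bilinearity to
`−c⟪g, Tω⟫ − c⟪ω, Tg⟫ + 2c²⟪ω, Tω⟫` (`g = v − w`, `psiT_Dq_expand`), and each of the three terms is Lipschitz on the
unit sphere with constants `2|g|²`, `2|g|²`, `8|g|²` (Cauchy–Schwarz and `‖Tu‖ ≤ ‖u‖`; `psiT_core_lipschitz`, real
bookkeeping `psiT_real_bookkeeping`). Dividing by `12|g|²` (the value is `0` when `v = w`, as `(12·0)⁻¹ = 0`) the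
mark `ψ_T(s, x, v, w, n) = Dq_T(v, w, n/|n|) / (12|v − w|²)` is `1`-Lipschitz in the unit normal
(`stub_psiT_lipschitz`, the registered signature verbatim).

References: folklore (elementary inner-product-space estimates).
-/

noncomputable section

open scoped RealInnerProductSpace

namespace Summit.AtomisticToContinuum.HydrodynamicLimit.Theorems.ContactAngleEquidistributionSketch

open Literature.MathematicalPhysics.KineticTheory

/-- Real bookkeeping behind the Lipschitz estimate: if `|c|, |c'|, |X|, |Y| ≤ G`, `|Z| ≤ 1` and the increments
are `|c − c'|, |X − X'|, |Y − Y'| ≤ G d`, `|Z − Z'| ≤ 2d`, then the increment of `−cX − cY + 2c²Z` is at most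
`12 G² d`. [folklore] -/
theorem psiT_real_bookkeeping {c c' X X' Y Y' Z Z' G d : ℝ} (hG : 0 ≤ G) (hd : 0 ≤ d)
    (hc : |c| ≤ G) (hc' : |c'| ≤ G) (hcc : |c - c'| ≤ G * d)
    (hX : |X| ≤ G) (hXX : |X - X'| ≤ G * d)
    (hY : |Y| ≤ G) (hYY : |Y - Y'| ≤ G * d)
    (hZ : |Z| ≤ 1) (hZZ : |Z - Z'| ≤ 2 * d) :
    |(-(c * X) - c * Y + 2 * c ^ 2 * Z) - (-(c' * X') - c' * Y' + 2 * c' ^ 2 * Z')| ≤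
      12 * G ^ 2 * d := by
  have hGd : 0 ≤ G * d := mul_nonneg hG hd
  have h1 : |c * X - c' * X'| ≤ 2 * G ^ 2 * d := by
    have e1 : c * X - c' * X' = (c - c') * X + c' * (X - X') := by ring
    rw [e1]
    calc |(c - c') * X + c' * (X - X')| ≤ |(c - c') * X| + |c' * (X - X')| := abs_add_le _ _
      _ = |c - c'| * |X| + |c'| * |X - X'| := by rw [abs_mul, abs_mul]
      _ ≤ G * d * G + G * (G * d) :=
          add_le_add (mul_le_mul hcc hX (abs_nonneg _) hGd) (mul_le_mul hc' hXX (abs_nonneg _) hG)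
      _ = 2 * G ^ 2 * d := by ring
  have h2 : |c * Y - c' * Y'| ≤ 2 * G ^ 2 * d := by
    have e2 : c * Y - c' * Y' = (c - c') * Y + c' * (Y - Y') := by ring
    rw [e2]
    calc |(c - c') * Y + c' * (Y - Y')| ≤ |(c - c') * Y| + |c' * (Y - Y')| := abs_add_le _ _
      _ = |c - c'| * |Y| + |c'| * |Y - Y'| := by rw [abs_mul, abs_mul]
      _ ≤ G * d * G + G * (G * d) :=
          add_le_add (mul_le_mul hcc hY (abs_nonneg _) hGd) (mul_le_mul hc' hYY (abs_nonneg _) hG)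
      _ = 2 * G ^ 2 * d := by ring
  have h3 : |c ^ 2 * Z - c' ^ 2 * Z'| ≤ 4 * G ^ 2 * d := by
    have e3 : c ^ 2 * Z - c' ^ 2 * Z' = (c - c') * ((c + c') * Z) + c' ^ 2 * (Z - Z') := by ring
    have hcpc : |c + c'| ≤ 2 * G := (abs_add_le _ _).trans (by linarith)
    have hA : |(c + c') * Z| ≤ 2 * G := by
      rw [abs_mul]
      calc |c + c'| * |Z| ≤ 2 * G * 1 := mul_le_mul hcpc hZ (abs_nonneg _) (by linarith)
        _ = 2 * G := mul_one _
    have hB : |(c - c') * ((c + c') * Z)| ≤ G * d * (2 * G) := by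
      rw [abs_mul]
      exact mul_le_mul hcc hA (abs_nonneg _) hGd
    have hc'2 : |c' ^ 2| ≤ G ^ 2 := by
      rw [abs_of_nonneg (sq_nonneg c')]
      exact sq_le_sq' (abs_le.mp hc').1 (abs_le.mp hc').2
    have hC : |c' ^ 2 * (Z - Z')| ≤ G ^ 2 * (2 * d) := by
      rw [abs_mul]
      exact mul_le_mul hc'2 hZZ (abs_nonneg _) (sq_nonneg G)
    rw [e3]
    calc |(c - c') * ((c + c') * Z) + c' ^ 2 * (Z - Z')|
        ≤ |(c - c') * ((c + c') * Z)| + |c' ^ 2 * (Z - Z')| := abs_add_le _ _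
      _ ≤ G * d * (2 * G) + G ^ 2 * (2 * d) := add_le_add hB hC
      _ = 4 * G ^ 2 * d := by ring
  have e : (-(c * X) - c * Y + 2 * c ^ 2 * Z) - (-(c' * X') - c' * Y' + 2 * c' ^ 2 * Z') =
      -((c * X - c' * X') + (c * Y - c' * Y')) + 2 * (c ^ 2 * Z - c' ^ 2 * Z') := by ring
  rw [e]
  calc |-((c * X - c' * X') + (c * Y - c' * Y')) + 2 * (c ^ 2 * Z - c' ^ 2 * Z')|
      ≤ |-((c * X - c' * X') + (c * Y - c' * Y'))| + |2 * (c ^ 2 * Z - c' ^ 2 * Z')| := abs_add_le _ _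
    _ ≤ (|c * X - c' * X'| + |c * Y - c' * Y'|) + 2 * |c ^ 2 * Z - c' ^ 2 * Z'| := by
        rw [abs_neg, abs_mul, abs_two]
        exact add_le_add (abs_add_le _ _) le_rfl
    _ ≤ (2 * G ^ 2 * d + 2 * G ^ 2 * d) + 2 * (4 * G ^ 2 * d) := by linarith [h1, h2, h3]
    _ = 12 * G ^ 2 * d := by ring

/-- Bilinear expansion of the collisional change of `q(v) = ⟪v, T v⟫` under the reflection of the pair `(v, w)`
along `n` with transferred component `c = ⟪v − w, n⟫`:
`q(v − c n) + q(w + c n) − q(v) − q(w) = −c⟪v − w, T n⟫ − c⟪n, T (v − w)⟫ + 2c²⟪n, T n⟫`. [folklore] -/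
theorem psiT_Dq_expand {E : Type*} [NormedAddCommGroup E] [InnerProductSpace ℝ E] (T : E →L[ℝ] E)
    (v w n : E) :
    ⟪v - ⟪v - w, n⟫ • n, T (v - ⟪v - w, n⟫ • n)⟫ + ⟪w + ⟪v - w, n⟫ • n, T (w + ⟪v - w, n⟫ • n)⟫ -
        ⟪v, T v⟫ - ⟪w, T w⟫ =
      -(⟪v - w, n⟫ * ⟪v - w, T n⟫) - ⟪v - w, n⟫ * ⟪n, T (v - w)⟫ + 2 * ⟪v - w, n⟫ ^ 2 * ⟪n, T n⟫ := by
  simp only [map_sub, map_add, map_smul, inner_sub_left, inner_sub_right, inner_add_left, inner_add_right,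
    real_inner_smul_left, real_inner_smul_right]
  ring

/-- The expanded collisional change `−c⟪g, Tω⟫ − c⟪ω, Tg⟫ + 2c²⟪ω, Tω⟫`, `c = ⟪g, ω⟫`, is `12|g|²`-Lipschitz in
the unit vector `ω` when `‖T‖ ≤ 1` (Cauchy–Schwarz, `‖T u‖ ≤ ‖u‖`, and `psiT_real_bookkeeping`). [folklore] -/
theorem psiT_core_lipschitz {E : Type*} [NormedAddCommGroup E] [InnerProductSpace ℝ E] (T : E →L[ℝ] E)
    (hT : ‖T‖ ≤ 1) (g : E) {n n' : E} (hn : ‖n‖ = 1) (hn' : ‖n'‖ = 1) :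
    |(-(⟪g, n⟫ * ⟪g, T n⟫) - ⟪g, n⟫ * ⟪n, T g⟫ + 2 * ⟪g, n⟫ ^ 2 * ⟪n, T n⟫) -
        (-(⟪g, n'⟫ * ⟪g, T n'⟫) - ⟪g, n'⟫ * ⟪n', T g⟫ + 2 * ⟪g, n'⟫ ^ 2 * ⟪n', T n'⟫)| ≤
      12 * ‖g‖ ^ 2 * ‖n - n'‖ := by
  have hTle : ∀ u : E, ‖T u‖ ≤ ‖u‖ := fun u =>
    (T.le_opNorm u).trans (mul_le_of_le_one_left (norm_nonneg u) hT)
  have hTn : ‖T n‖ ≤ 1 := (hTle n).trans hn.le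
  have hc : |⟪g, n⟫| ≤ ‖g‖ := (abs_real_inner_le_norm g n).trans (by rw [hn, mul_one])
  have hc' : |⟪g, n'⟫| ≤ ‖g‖ := (abs_real_inner_le_norm g n').trans (by rw [hn', mul_one])
  have hcc : |⟪g, n⟫ - ⟪g, n'⟫| ≤ ‖g‖ * ‖n - n'‖ := by
    rw [← inner_sub_right]
    exact abs_real_inner_le_norm _ _
  have hX : |⟪g, T n⟫| ≤ ‖g‖ :=
    (abs_real_inner_le_norm _ _).trans
      ((mul_le_mul_of_nonneg_left hTn (norm_nonneg g)).trans (mul_one _).le)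
  have hXX : |⟪g, T n⟫ - ⟪g, T n'⟫| ≤ ‖g‖ * ‖n - n'‖ := by
    rw [← inner_sub_right, ← map_sub]
    exact (abs_real_inner_le_norm _ _).trans (mul_le_mul_of_nonneg_left (hTle _) (norm_nonneg _))
  have hY : |⟪n, T g⟫| ≤ ‖g‖ :=
    (abs_real_inner_le_norm _ _).trans (by rw [hn, one_mul]; exact hTle g)
  have hYY : |⟪n, T g⟫ - ⟪n', T g⟫| ≤ ‖g‖ * ‖n - n'‖ := by
    rw [← inner_sub_left]
    calc |⟪n - n', T g⟫| ≤ ‖n - n'‖ * ‖T g‖ := abs_real_inner_le_norm _ _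
      _ ≤ ‖n - n'‖ * ‖g‖ := mul_le_mul_of_nonneg_left (hTle g) (norm_nonneg _)
      _ = ‖g‖ * ‖n - n'‖ := mul_comm _ _
  have hZ : |⟪n, T n⟫| ≤ 1 :=
    (abs_real_inner_le_norm _ _).trans (by rw [hn, one_mul]; exact hTn)
  have hZZ : |⟪n, T n⟫ - ⟪n', T n'⟫| ≤ 2 * ‖n - n'‖ := by
    have e : ⟪n, T n⟫ - ⟪n', T n'⟫ = ⟪n - n', T n⟫ + ⟪n', T (n - n')⟫ := by
      rw [inner_sub_left, map_sub, inner_sub_right]; ring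
    rw [e]
    calc |⟪n - n', T n⟫ + ⟪n', T (n - n')⟫| ≤ |⟪n - n', T n⟫| + |⟪n', T (n - n')⟫| := abs_add_le _ _
      _ ≤ ‖n - n'‖ * ‖T n‖ + ‖n'‖ * ‖T (n - n')‖ :=
          add_le_add (abs_real_inner_le_norm _ _) (abs_real_inner_le_norm _ _)
      _ ≤ ‖n - n'‖ * 1 + 1 * ‖n - n'‖ := by
          rw [hn']
          exact add_le_add (mul_le_mul_of_nonneg_left hTn (norm_nonneg _))
            (by rw [one_mul, one_mul]; exact hTle _)
      _ = 2 * ‖n - n'‖ := by ring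
  exact psiT_real_bookkeeping (norm_nonneg g) (norm_nonneg _) hc hc' hcc hX hXX hY hYY hZ hZZ

/-- **Registered stub `stub_psiT_lipschitz` (line `Sketch` v8).** The collision-difference mark
`ψ_T(s, x, v, w, n) = Dq_T(v, w, n/|n|) / (12|v − w|²)` of the quadratic observable `q(v) = ⟪v, T v⟫` is
`1`-Lipschitz in the unit normal when `‖T‖ ≤ 1`: `Dq_T(v, w, ·)` is `12|v − w|²`-Lipschitz on the unit sphere
(it is `−c⟪g,Tω⟫ − c⟪ω,Tg⟫ + 2c²⟪ω,Tω⟫`, `c = ⟪g, ω⟫`, `g = v − w`), and the value is `0` at `v = w`.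
[folklore] -/
theorem stub_psiT_lipschitz (T : V3 →L[ℝ] V3) (hT : ‖T‖ ≤ 1) :
    let refl : V3 → V3 × V3 → V3 × V3 := fun n p =>
      (p.1 - ⟪p.1 - p.2, n⟫ • n, p.2 + ⟪p.1 - p.2, n⟫ • n)
    let Dq : V3 → V3 → V3 → ℝ := fun v w n =>
      ⟪(refl n (v, w)).1, T (refl n (v, w)).1⟫ + ⟪(refl n (v, w)).2, T (refl n (v, w)).2⟫ -
        ⟪v, T v⟫ - ⟪w, T w⟫
    let ψ : ℝ → T3 → V3 → V3 → V3 → ℝ := fun _ _ v w n =>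
      (12 * ‖v - w‖ ^ 2)⁻¹ * Dq v w (‖n‖⁻¹ • n)
    ∀ s x v w (n n' : V3), ‖n‖ = 1 → ‖n'‖ = 1 → |ψ s x v w n - ψ s x v w n'| ≤ ‖n - n'‖ := by
  intro refl Dq ψ s x v w n n' hn hn'
  have hD : |Dq v w n - Dq v w n'| ≤ 12 * ‖v - w‖ ^ 2 * ‖n - n'‖ := by
    have h := psiT_core_lipschitz T hT (v - w) hn hn'
    rw [← psiT_Dq_expand T v w n, ← psiT_Dq_expand T v w n'] at h
    exact h
  show |(12 * ‖v - w‖ ^ 2)⁻¹ * Dq v w (‖n‖⁻¹ • n) - (12 * ‖v - w‖ ^ 2)⁻¹ * Dq v w (‖n'‖⁻¹ • n')| ≤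
    ‖n - n'‖
  have h12 : 0 ≤ 12 * ‖v - w‖ ^ 2 := by positivity
  rw [hn, hn', inv_one, one_smul, one_smul, ← mul_sub, abs_mul, abs_inv, abs_of_nonneg h12]
  rcases h12.eq_or_lt with h0 | hpos
  · rw [← h0, inv_zero, zero_mul]
    exact norm_nonneg _
  · rw [inv_mul_le_iff₀ hpos]
    exact hD

end Summit.AtomisticToContinuum.HydrodynamicLimit.Theorems.ContactAngleEquidistributionSketch
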